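import Mathlib
import HarnessLib
import HarnessLib.Audit
import Summits.RiemannHypothesis.Statement
import Literature.NumberTheory.LFunctions.WeilExplicit
import Literature.NumberTheory.LFunctions.ZetaZeros
import Literature.NumberTheory.DiophantineGeometry.NamedHypotheses
import HarnessLib.Audit.Status.Attr

/-!
Route: WeilHeightWindowBarrier

# Route WeilHeightWindowBarrier — Weil height-window barrier: verified height T buys Weil positivity
only up to window of order log T over S*(T); phantom zero clusters defeat window 2 at the
Platt-Trudgian height

LINE 3 of the D-0145 ideator seat rh-idea-4 (technique card ASSUME-THE-OPPOSITE: build the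
counterexample until it breaks), column WEIL of the RH ladder,
proposed barrier rung «WEIL · HEIGHT–WINDOW BARRIER» (director to number; mint ask below). Assume RH
false and try to BUILD the violating Weil test function of
window a (support in [-a, a]) that Yoshida's Prop. 6 promises: on the ZERO side Q(g) = sum_rho
m(rho) ghat(rho) conj ghat(1 - conj rho) (`SpectralExpansion`),
every zero below the verified height T = 3 000 175 332 800 (Platt-Trudgian, tree named fact) is on
the line and contributes |ghat|^2 >= 0, so negativity must be
extracted from off-line zeros ABOVE T, against the positive mass of their neighbours. Everything an
RH-free, height-based argument can use about those zeros is
collected in an ADMISSIBILITY predicate on phantom zero configurations Z : C -> N (open strip;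
conjugation and rho -> 1 - conj rho symmetry; on the line up to
height T; Mossinghoff-Trudgian zero-free region; Riemann-von Mangoldt count with the explicit
Hasanalizade-Shen-Wong discrepancy |N(t) - N_0(t)| <= S*(t) =
0.1038 log t + 0.2573 log log t + 9.3675). The counterexample DOES NOT BREAK: a cluster of about 2
S*(T) off-line phantom points just above T, balanced by a
gap, together with an odd bump times a carrier of window about 1.2 log(T/2 pi)/(2 S*(T)), has
NEGATIVE spectral sum (toy extremal jobs j290336, j290378); so no
argument from «RH to height T + counting + symmetry + zero-free region» can certify
`WeilPositivityOn a` beyond that window, in particular not window 2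
(≈ the prime-side numerics frontier (log 73)/2) at the Platt-Trudgian height (`PhantomAtPT`), nor
window 2 log T / S*(T) at any height (`PhantomLaw`);
conversely height DOES buy the window log T/(8 S*(T)) against every admissible configuration
(`LowerLaw`, the sampling side). X = `HeightWindowBarrier` =
SpectralExpansion ∧ ZetaAdmissible ∧ LowerLaw ∧ PhantomLaw ∧ PhantomAtPT: the two-sided EXCHANGE
RATE «window ≍ log T / S*(T)» between verified height and
Weil window. `closes` concludes X from the five items (conclusion-mismatch with the summit Statement
by design: this is a BARRIER/EXCHANGE-RATE rung like
L6 NbTruncationBarrier / L24; it is re-targeted by `ledger route edit --closes-target` once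
director-rh mints the alt-closer
«WeilHeightWindowBarrier =
Summit.RiemannHypothesis.RiemannHypothesis.Theses.WeilHeightWindowBarrier.HeightWindowBarrier»). No
summit is proved by this
line; nothing here bears on the truth of RH.
Lean: `SpectralExpansion ∧ ZetaAdmissible ∧ LowerLaw ∧ PhantomLaw ∧ PhantomAtPT`

Rationale: WHY THIS LINE. The Weil column's data programme certifies `WeilPositivityOn a` prime-side (H(q)
steps, q <= 73, window ≈ 2.1; banked theorem `WeilPositivityOn 1`,
A1 rung), while the Li column has a CAL rung «Keiper-Li positivity from RH-to-height» (tree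
`KeiperLi`); the natural question whether verified HEIGHT can
replace prime-side certificates for Weil WINDOWS (Montgomery's support <-> height duality from pair
correlation, Montgomery 1973; Bombieri2000Weil §§3-5;
Yoshida1992 Prop. 6 and Thm 1) has no answer in the tree or in print that we could find. This line
answers it with an explicit exchange rate and a
barrier: the obstruction is not zero DENSITY but the local CLUSTERING freedom left by the explicit
S(t) bounds (Hasanalizade-Shen-Wong arXiv:2107.06506
Thm 1.1; Trudgian 2014), exactly the quantity of the catalogued `BoundedFluctuationCounting` entry,
and the construction is an extremal problem for entire
functions of exponential type sampled on a perturbed lattice (Paley-Wiener / Beurling-Landau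
sampling theory, imported from harmonic analysis). Inputs by
name: `Literature.NumberTheory.LFunctions.weilMellin`, `IsWeilTest`, `weilQuadratic`,
`explicit_formula` (PROVED), `riemannZetaZeroOrder`, `zetaZeroCount`,
`Literature.NumberTheory.DiophantineGeometry.RiemannHypothesisUpTo`, `platt_trudgian_numerical_rh`;
prints as hypotheses only (HSW count, Mossinghoff-Trudgian
arXiv:1410.3926 zero-free region). Technique that generated the line: assume-the-opposite (the
phantom RH-false world is built explicitly and survives every
RH-free constraint at window 2).

RANKED CRUXES. #0 HeightWindowBarrier (target) — The height-window exchange rate: the spectral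
expansion of Weil's quadratic functional, admissibility of the true zeros at every verified height,
the lower law (height T certifies every window <= log T/(8 S*(T)) against all admissible
configurations), the phantom law (window 2 log T/S*(T) is defeated by an admissible configuration at
every T >= 10^6) and the phantom at the Platt-Trudgian height (window 2 defeated at T = 3 000 175
332 800). (why it might fail: it is the conjunction; it fails iff one of LowerLaw / PhantomLaw /
PhantomAtPT fails (the two support conjuncts are routine).) [Bombieri2000Weil, Yoshida1992,
arXiv:2107.06506, arXiv:1410.3926, PlattTrudgian2021]
#2 LowerLaw (crux) — For every T >= 10^6 and every admissible phantom configuration Z at height T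
(open strip, the two symmetries, on the line up to height T, Mossinghoff-Trudgian zero-free region,
locally finite, Riemann-von Mangoldt count within S*(t) for t >= e), NO Weil test function of window
log T/(8 S*(T)) has negative (absolutely convergent) spectral sum sum_rho Z(rho) ghat(rho) conj
ghat(1 - conj rho). At the Platt-Trudgian height the certified window is ≈ 0.27. [difficulty: L]
(why it might fail: the constant 1/8 comes from a resonant-lobe toy (odd real carriers; violation
first at ≈ 0.6 log(T/2pi)/S*); complex or multi-lobe test functions coupling several phantom
clusters coherently could push the true threshold below log T/(8 S*(T)).) [Bombieri2000Weil,
arXiv:2107.06506, Yoshida1992]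
#3 PhantomLaw (crux) — For every T >= 10^6 there is an admissible phantom configuration at height T
(on-line lattice-like points tracking N_0 up to T, then a cluster of about 2 S*(T) - 2 points at
real part 0.99 and one common height just above T, compensated by a gap) and a Weil test function of
window 2 log T / S*(T) (an odd C^infty bump concentrated near the ends of the window times
cos(gamma_0 t)) whose spectral sum is negative. [difficulty: M] (why it might fail: uniformity in T:
the toy threshold tends to ≈ 5.8 (cluster 2 S*(T) ~ 0.21 log T) vs the claimed 19.3, but the
non-resonant and far-field tails of the C^infty bump must be bounded uniformly in T; lattice
commensurability could raise the threshold at isolated T.) [arXiv:2107.06506, arXiv:1410.3926,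
Bombieri2000Weil]
#4 PhantomAtPT (crux) — At the Platt-Trudgian height T = 3 000 175 332 800 (log(T/2pi) = 26.9, S*(T)
= 13.2) there is an admissible phantom configuration and a Weil test function supported in [-2, 2]
with negative spectral sum: verified height plus counting plus symmetry plus the classical zero-free
region cannot certify WeilPositivityOn 2. [difficulty: M] (why it might fail: the toy finds the
first violating window at 1.25 (basis of 24 odd modes, C^1 taper, resonant-lobe approximation); the
margin to 2 is a factor 1.6 and must absorb the C^infty smoothing of the taper and the exact
(non-resonant) quadratic form.) [PlattTrudgian2021, arXiv:2107.06506, arXiv:1410.3926]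
#9 SpectralExpansion (support) — For every Weil test function g the zero side of Q(g) = W(g * g~)
converges absolutely and Q(g) = sum over the non-trivial zeros rho (with multiplicity) of ghat(rho)
conj ghat(1 - conj rho): the tree's PROVED explicit formula `explicit_formula` applied to g * g~,
with `weilMellin_weilConv`, `weilMellin_weilReflect` and the Schwartz decay of ghat on vertical
strips. [difficulty: M] [Bombieri2000Weil]
#9 ZetaAdmissible (support) — Given the Hasanalizade-Shen-Wong count |N(t) - N_0(t)| <= S*(t) (t >=
e) and the Mossinghoff-Trudgian zero-free region as hypotheses, the multiplicity function of the
non-trivial zeros of zeta is an admissible configuration at every height T with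
RiemannHypothesisUpTo T (conjugation: `riemannZeta_conj`; functional equation; discreteness of
zeros; `zetaZeroCount` = the finsum of `riemannZetaZeroOrder`). [difficulty: M] [arXiv:2107.06506,
arXiv:1410.3926, PlattTrudgian2021]

TWO-LAYER PLAN. Foreseen glued splits (tenure, not now): PhantomAtPT into (a) an explicit finite
configuration-plus-test-function certificate in interval arithmetic for the
truncated spectral sum over |Im rho - gamma_0| <= 60 (kit job, then a `decide`/interval port) and
(b) an analytic tail lemma bounding all other terms by the
C^infty bump's decay; LowerLaw into (a) a cluster lemma (an admissible configuration has at most 2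
S*(t) + (h/2 pi) log t points in any height window of
length h above T) and (b) a Paley-Wiener sampling inequality for odd/even resonant decompositions.

KILL CRITERIA. The line is dead if PhantomAtPT is refuted (a proof that every admissible
configuration at the Platt-Trudgian height has non-negative spectral sums on window 2:
then height DOES buy the numerics frontier and the barrier is false) or if LowerLaw is refuted at
its stated constant by an explicit admissible configuration
and test function (then the exchange rate has no lower side; PhantomLaw/PhantomAtPT would survive as
a one-sided barrier and the route is re-filed thinner).

NOT DECOMPOSED YET. The C^infty-versus-C^1 taper bookkeeping, the exact non-resonant terms of the
quadratic form, the interval certificate format, and the even/complex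
test-function cases of LowerLaw are deliberately not itemised until PhantomAtPT's certificate
exists.

CHEAPEST FALSIFIER. Re-run the extremal toy WITHOUT the resonant-lobe approximation (full quadratic
form ghat(rho) conj ghat(1 - conj rho) for g = phi(t) cos(gamma_0 t), C^infty
bump basis, gamma_0 = T + 50, all phantom points within +-200 of gamma_0 plus the analytic far-field
bound) at L = 26.9, cluster 24, window 2: if the minimal
generalised eigenvalue is NOT negative, PhantomAtPT dies (one kit job, about 5 core-minutes).
Instrument row: the W-D Weil-form machinery / any engine seat;
my jobs j290336 (true zeros near the 1000th zero) and j290378 (lattice scan L = 5.4 ... 27) are the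
calibration.

NUMBERS. Toy (resonant-lobe model, odd basis of 24 modes with (1 - (t/a)^2)^2 taper; violation =
negative minimal generalised eigenvalue), first violating window a*:
single displaced zero among TRUE neighbours near gamma_1000 = 1419.4 (L = log(gamma/2pi) = 5.42,
spacing 1.16): beta' = 0.49 -> 3.0 (one-lobe law
(pi^2 L/(6 beta'^2))^(1/3) = 3.34), 0.4 -> 3.5 (3.82), 0.3 -> 3.5, 0.2 -> 5 (6.06), 0.1 -> 6 (9.62),
0.05 -> none <= 20 (j290336). Lattice + cluster of K
off-line points (beta' = 0.49) at one height + gap of K (j290378): L = 27: K = 1, 2, 4, 8, 13, 26 ->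
a* = 4.5, 3.75, 3.0, 2.5, 2.0, 1.25; L = 20: 4.5, 3.5,
2.75, 2.0, 1.5, 1.0; L = 15: 3.75, 3.25, 2.5, 1.75, 1.25, 0.75; L = 10: 3.5, 2.75, 2.0, 1.5, 1.0,
0.5; L = 5.42: 2.75, 2.25, 1.5, 1.0, 0.75, 0.25 — law
a* ≈ 1.2 L/K for K >= 8 (gap-driven). All-off-line lattice without moves: a* = 3 at L = 5.42
(density alone protects small windows). Platt-Trudgian height:
L = 26.9, S* = 13.2, admissible cluster K ≈ 24 -> a* ≈ 1.35 < 2 (PhantomAtPT margin 1.5x); LowerLaw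
constant: log T/(8 S*) = 0.27 vs a* ≈ 1.2-1.35 (margin 4.5x);
PhantomLaw: window 2 log T/S* = 4.35 at PT, -> 19.3 as T -> oo vs a* -> 1.2/(2 x 0.1038) ≈ 5.8
(margin >= 3.3x for all T >= 10^6: at T = 10^6, L = 12.0,
S* = 11.5, K = 23, a* ≈ 0.63 vs claimed 2.4).

DEFINITION REQUESTS. - WeilPhantomAdmissible (topic
Summits/RiemannHypothesis/RiemannHypothesis/Theorems): factor the inline admissibility predicate
`Admissible T Z`, the
  configuration count and `NegativeWindow Z a` of this route's items into named defs (sketch: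
HOME/rh-idea-4/weil/Sketch.lean, rc 0) so that tenure splits
  and the certificate port can cite them by name.

Novelty: Searches RUN (2026-08-27T21:1xZ): `lit search --hybrid "Weil explicit formula positivity test
function support partial verification Riemann hypothesis height"`
(8 docs: Finch 2003 p219, Bombieri-Gubler 2006, van Frankenhuijsen 2014, Miller-Takloo-Bighash,
Lapidus-van Frankenhuijsen (eds) 2001, Edwards 1974, Baker 2012 -
none on height => window); `lit vsearch "positivity of Weil's quadratic functional for test
functions of small support follows from numerical verification of
RH up to height T"` (Montgomery-Vaughan 2007 pp 319/247, Ivic 1985, Miller-TB - generic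
explicit-formula pages, no such statement); `lit search --hybrid
"limitations of numerical verification of the Riemann hypothesis zeros off the line above height T
explicit formula"` (MV 2007 p322, Edwards p265 - Turing's
method, not Weil windows); `lit galaxy search "Weil positivity|explicit formula positivity|small
support" --star all` and `--star pdf` (0 relevant: substring
hits are unrelated books/theses); corpus confirmation of the counting constants
[corpus:paper:arxiv-2107.06506 p.3 Thm 1.1, L63-66]. In-tree nearest objects:
`Literature.NumberTheory.LFunctions.KeiperLi` (CAL: Li coefficients from RH-to-height - the
Li-column analogue whose Weil-column counterpart this line shows
to be capped), `AlternativeHypothesisConsequences` (GLSS 2026: RH-free consequences of a fake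
zero-spacing hypothesis - configurations constrained by counting,
different functional), `Literature.Barriers.RiemannHypothesis.BoundedFluctuat  [refs: paper:arxiv-2107.06506]

Barriers (technique_class: weil-explicit-formula, partial-rh, zero-counting, barrier): - technique_class: weil-explicit-formula, partial-rh, zero-counting, barrier
- Literature.Barriers.RiemannHypothesis.BoundedFluctuationCounting: outside - that entry refutes
spectral MODELS whose count stays within O(1) of N_0 (S(T) is unbounded, Selberg 1946); this line
never posits a model of the zeros: it quantifies over ALL configurations within the explicit HSW
discrepancy S*(t) (which is unbounded, 0.1038 log t + ...) and only claims existence of phantom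
ones; the barrier's quantity S(T) is precisely the exchange-rate denominator here.
- Literature.Barriers.RiemannHypothesis.BrouckeDebruyneRevesz2023_thm13: outside, same spirit - the
Beurling counterexamples (Diamond-Montgomery-Vorhauer 2006; Broucke-Debruyne-Revesz 2023) are
RH-false generalized-prime systems satisfying prime-side axioms; the phantom configurations here are
the zero-side analogue restricted to what height verification certifies, and the claim is a barrier
for a METHOD (height => window), not a model of zeta.
- SemilocalCutoffInnerCriterion (catalogue file, W column): does not apply - no operator cutoff /
semilocal trace formula is used; the functional is Weil's global Q(g) on its zero side.
- Literature.Barriers.RiemannHypothesis.LittlewoodOscillation: does not apply (nor MertensDisproof)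
- no prime-sum sign law and no M(x) hypothesis; primes do not enter (zero side only).
- B12 (rh-split letters, Weil-cone dilation barrier) and the CLASS-(a) wall: not met - the line
claims no positivity beyond window

History (route lifecycle, newest last):
- 2026-08-27T21:35:56Z · CLOSED superseded — superseded:route-RiemannHypothesis-WeilAdversary (planner-rh-idea-4-g0-0)

sub-problem: RiemannHypothesis · status: draft · opened planner-rh-idea-4-g0-0 2026-08-27T21:19:18Z · rev 0 · ledger route-RiemannHypothesis-WeilHeightWindowBarrier
GENERATED by the gate from the ledger (D-0016/17). Provers cite these decls: `theorem foo : Summit.RiemannHypothesis.RiemannHypothesis.Theses.WeilHeightWindowBarrier.<Decl> := …` in Summits/RiemannHypothesis/RiemannHypothesis/Theorems/<Name>.lean.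
-/

namespace Summit.RiemannHypothesis.RiemannHypothesis.Theses.WeilHeightWindowBarrier

open scoped BigOperators Topology Manifold Classical MeasureTheory ProbabilityTheory Matrix InnerProductSpace ComplexConjugate ContinuousMap
open Filter Set Function TopologicalSpace MeasureTheory

attribute [summit_statement] _root_.Summit.RiemannHypothesis

open Summit

/-- item stmt-RiemannHypothesis-22809 · crux · rank 2 · closed · moot by None · by planner
why it might fail: the constant 1/8 comes from a resonant-lobe toy (odd real carriers; violation first at ≈ 0.6 log(T/2pi)/S*); complex or multi-lobe test functions coupling several phantom clusters coherently could push the true threshold below log T/(8 S*(T)).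
sources: Bombieri2000Weil, arXiv:2107.06506, Yoshida1992
[crux] For every T >= 10^6 and every admissible phantom configuration Z at height T (open strip, the
two symmetries, on the line up to height T, Mossinghoff-Trudgian zero-free region, locally finite,
Riemann-von Mangoldt count within S*(t) for t >= e), NO Weil test function of window log T/(8 S*(T))
has negative (absolutely convergent) spectral sum sum_rho Z(rho) ghat(rho) conj ghat(1 - conj rho).
At the Platt-Trudgian height the certified window is ≈ 0.27. [difficulty: L] -/
@[route_item "route-RiemannHypothesis-WeilHeightWindowBarrier", crux]
def LowerLaw : Prop :=
  ∀ T : ℝ, 10 ^ 6 ≤ T → ∀ Z : ℂ → ℕ, ((∀ ρ : ℂ, Z ρ ≠ 0 → 0 < ρ.re ∧ ρ.re < 1) ∧ (∀ ρ : ℂ, Z ((starRingEnd ℂ) ρ) = Z ρ ∧ Z (1 - (starRingEnd ℂ) ρ) = Z ρ) ∧ (∀ ρ : ℂ, Z ρ ≠ 0 → |ρ.im| ≤ T → ρ.re = 1 / 2) ∧ (∀ ρ : ℂ, Z ρ ≠ 0 → 2 ≤ |ρ.im| → ρ.re ≤ 1 - 1 / (5.573412 * Real.log |ρ.im|)) ∧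 (∀ t : ℝ, {ρ : ℂ | Z ρ ≠ 0 ∧ 0 < ρ.im ∧ ρ.im ≤ t}.Finite) ∧ (∀ t : ℝ, Real.exp 1 ≤ t → |(∑ᶠ ρ ∈ {ρ : ℂ | 0 < ρ.im ∧ ρ.im ≤ t}, (Z ρ : ℝ)) - (t / (2 * Real.pi) * Real.log (t / (2 * Real.pi * Real.exp 1)) + 7 / 8)| ≤ (0.1038 * Real.log t + 0.2573 * Real.log (Real.log t) + 9.3675))) → ¬ (∃ g : ℝ → ℂ, Literature.NumberTheory.LFunctions.IsWeilTest g ∧ tsupport g ⊆ Set.Icc (-(Real.log T / (8 * (0.1038 * Real.log T + 0.2573 * Real.log (Real.log T) + 9.3675)))) (Real.log T / (8 * (0.1038 * Real.log T + 0.2573 * Real.log (Real.log T) + 9.3675))) ∧ Summable (fun ρ : ℂ ↦ (Z ρ : ℂ) * (Literature.NumberTheory.LFunctions.weilMellin g ρ * (starRingEnd ℂ) (Literature.NumberTheory.LFunctions.weilMellin g (1 - (starRingEnd ℂ) ρ)))) ∧ (∑' ρ : ℂ, (Z ρ : ℂ) * (Literature.NumberTheory.LFunctions.weilMellin g ρ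 * (starRingEnd ℂ) (Literature.NumberTheory.LFunctions.weilMellin g (1 - (starRingEnd ℂ) ρ)))).re < 0)

/-- item stmt-RiemannHypothesis-22810 · crux · rank 3 · closed · moot by None · by planner
why it might fail: uniformity in T: the toy threshold tends to ≈ 5.8 (cluster 2 S*(T) ~ 0.21 log T) vs the claimed 19.3, but the non-resonant and far-field tails of the C^infty bump must be bounded uniformly in T; lattice commensurability could raise the threshold at isolated T.
sources: arXiv:2107.06506, arXiv:1410.3926, Bombieri2000Weil
[crux] For every T >= 10^6 there is an admissible phantom configuration at height T (on-line
lattice-like points tracking N_0 up to T, then a cluster of about 2 S*(T) - 2 points at real part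
0.99 and one common height just above T, compensated by a gap) and a Weil test function of window 2
log T / S*(T) (an odd C^infty bump concentrated near the ends of the window times cos(gamma_0 t))
whose spectral sum is negative. [difficulty: M] -/
@[route_item "route-RiemannHypothesis-WeilHeightWindowBarrier", crux]
def PhantomLaw : Prop :=
  ∀ T : ℝ, 10 ^ 6 ≤ T → ∃ Z : ℂ → ℕ, ((∀ ρ : ℂ, Z ρ ≠ 0 → 0 < ρ.re ∧ ρ.re < 1) ∧ (∀ ρ : ℂ, Z ((starRingEnd ℂ) ρ) = Z ρ ∧ Z (1 - (starRingEnd ℂ) ρ) = Z ρ) ∧ (∀ ρ : ℂ, Z ρ ≠ 0 → |ρ.im| ≤ T → ρ.re = 1 / 2) ∧ (∀ ρ : ℂ, Z ρ ≠ 0 → 2 ≤ |ρ.im| → ρ.re ≤ 1 - 1 / (5.573412 * Real.log |ρ.im|)) ∧ (∀ t : ℝ, {ρ : ℂ | Z ρ ≠ 0 ∧ 0 < ρ.im ∧ ρ.im ≤ t}.Finite) ∧ (∀ t : ℝ, Real.exp 1 ≤ t → |(∑ᶠ ρ ∈ {ρ : ℂ | 0 < ρ.im ∧ ρ.im ≤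 t}, (Z ρ : ℝ)) - (t / (2 * Real.pi) * Real.log (t / (2 * Real.pi * Real.exp 1)) + 7 / 8)| ≤ (0.1038 * Real.log t + 0.2573 * Real.log (Real.log t) + 9.3675))) ∧ (∃ g : ℝ → ℂ, Literature.NumberTheory.LFunctions.IsWeilTest g ∧ tsupport g ⊆ Set.Icc (-(2 * Real.log T / (0.1038 * Real.log T + 0.2573 * Real.log (Real.log T) + 9.3675))) (2 * Real.log T / (0.1038 * Real.log T + 0.2573 * Real.log (Real.log T) + 9.3675)) ∧ Summable (fun ρ : ℂ ↦ (Z ρ : ℂ) * (Literature.NumberTheory.LFunctions.weilMellin g ρ * (starRingEnd ℂ) (Literature.NumberTheory.LFunctions.weilMellin g (1 - (starRingEnd ℂ) ρ)))) ∧ (∑' ρ : ℂ, (Z ρ : ℂ) * (Literature.NumberTheory.LFunctions.weilMellin g ρ * (starRingEnd ℂ) (Literature.NumberTheory.LFunctions.weilMellin g (1 - (starRingEnd ℂ) ρ)))).re < 0)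

/-- item stmt-RiemannHypothesis-22811 · crux · rank 4 · closed · moot by None · by planner
why it might fail: the toy finds the first violating window at 1.25 (basis of 24 odd modes, C^1 taper, resonant-lobe approximation); the margin to 2 is a factor 1.6 and must absorb the C^infty smoothing of the taper and the exact (non-resonant) quadratic form.
sources: PlattTrudgian2021, arXiv:2107.06506, arXiv:1410.3926
[crux] At the Platt-Trudgian height T = 3 000 175 332 800 (log(T/2pi) = 26.9, S*(T) = 13.2) there is
an admissible phantom configuration and a Weil test function supported in [-2, 2] with negative
spectral sum: verified height plus counting plus symmetry plus the classical zero-free region cannot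
certify WeilPositivityOn 2. [difficulty: M] -/
@[route_item "route-RiemannHypothesis-WeilHeightWindowBarrier", crux]
def PhantomAtPT : Prop :=
  ∃ Z : ℂ → ℕ, ((∀ ρ : ℂ, Z ρ ≠ 0 → 0 < ρ.re ∧ ρ.re < 1) ∧ (∀ ρ : ℂ, Z ((starRingEnd ℂ) ρ) = Z ρ ∧ Z (1 - (starRingEnd ℂ) ρ) = Z ρ) ∧ (∀ ρ : ℂ, Z ρ ≠ 0 → |ρ.im| ≤ 3000175332800 → ρ.re = 1 / 2) ∧ (∀ ρ : ℂ, Z ρ ≠ 0 → 2 ≤ |ρ.im| → ρ.re ≤ 1 - 1 / (5.573412 * Real.log |ρ.im|)) ∧ (∀ t : ℝ, {ρ : ℂ | Z ρ ≠ 0 ∧ 0 < ρ.im ∧ ρ.im ≤ t}.Finite) ∧ (∀ t : ℝ, Real.exp 1 ≤ t → |(∑ᶠ ρ ∈ {ρ : ℂ | 0 < ρ.im ∧ ρ.im ≤ t}, (Z ρ : ℝ)) - (t / (2 * Real.pi) * Real.log (t / (2 * Real.pi * Real.exp 1)) + 7 / 8)| ≤ (0.1038 * Real.log t + 0.2573 *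 Real.log (Real.log t) + 9.3675))) ∧ (∃ g : ℝ → ℂ, Literature.NumberTheory.LFunctions.IsWeilTest g ∧ tsupport g ⊆ Set.Icc (-(2)) (2) ∧ Summable (fun ρ : ℂ ↦ (Z ρ : ℂ) * (Literature.NumberTheory.LFunctions.weilMellin g ρ * (starRingEnd ℂ) (Literature.NumberTheory.LFunctions.weilMellin g (1 - (starRingEnd ℂ) ρ)))) ∧ (∑' ρ : ℂ, (Z ρ : ℂ) * (Literature.NumberTheory.LFunctions.weilMellin g ρ * (starRingEnd ℂ) (Literature.NumberTheory.LFunctions.weilMellin g (1 - (starRingEnd ℂ) ρ)))).re < 0)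

/-- item stmt-RiemannHypothesis-22812 · support · rank 9 · closed · moot by None · by planner
sources: Bombieri2000Weil
[support] For every Weil test function g the zero side of Q(g) = W(g * g~) converges absolutely and
Q(g) = sum over the non-trivial zeros rho (with multiplicity) of ghat(rho) conj ghat(1 - conj rho):
the tree's PROVED explicit formula `explicit_formula` applied to g * g~, with `weilMellin_weilConv`,
`weilMellin_weilReflect` and the Schwartz decay of ghat on vertical strips. [difficulty: M] -/
@[route_item "route-RiemannHypothesis-WeilHeightWindowBarrier", crux]
def SpectralExpansion : Prop :=
  ∀ g : ℝ → ℂ, Literature.NumberTheory.LFunctions.IsWeilTest g → Summable (fun ρ : ℂ ↦ (((fun ρ : ℂ ↦ if 0 < ρ.re ∧ ρ.re < 1 then (Literature.NumberTheory.LFunctions.riemannZetaZeroOrder ρ).toNat else 0) ρ : ℕ) : ℂ) * (Literature.NumberTheory.LFunctions.weilMellin g ρ * (starRingEnd ℂ) (Literature.NumberTheory.LFunctions.weilMellin g (1 - (starRingEnd ℂ) ρ)))) ∧ Literature.NumberTheory.LFunctions.weilQuadratic g = ∑' ρ : ℂ, (((fun ρ : ℂ ↦ if 0 < ρ.re ∧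 ρ.re < 1 then (Literature.NumberTheory.LFunctions.riemannZetaZeroOrder ρ).toNat else 0) ρ : ℕ) : ℂ) * (Literature.NumberTheory.LFunctions.weilMellin g ρ * (starRingEnd ℂ) (Literature.NumberTheory.LFunctions.weilMellin g (1 - (starRingEnd ℂ) ρ)))

/-- item stmt-RiemannHypothesis-22813 · support · rank 9 · closed · moot by None · by planner
sources: arXiv:2107.06506, arXiv:1410.3926, PlattTrudgian2021
[support] Given the Hasanalizade-Shen-Wong count |N(t) - N_0(t)| <= S*(t) (t >= e) and the
Mossinghoff-Trudgian zero-free region as hypotheses, the multiplicity function of the non-trivial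
zeros of zeta is an admissible configuration at every height T with RiemannHypothesisUpTo T
(conjugation: `riemannZeta_conj`; functional equation; discreteness of zeros; `zetaZeroCount` = the
finsum of `riemannZetaZeroOrder`). [difficulty: M] -/
@[route_item "route-RiemannHypothesis-WeilHeightWindowBarrier", crux]
def ZetaAdmissible : Prop :=
  (∀ t : ℝ, Real.exp 1 ≤ t → |((Literature.NumberTheory.LFunctions.zetaZeroCount t : ℕ) : ℝ) - (t / (2 * Real.pi) * Real.log (t / (2 * Real.pi * Real.exp 1)) + 7 / 8)| ≤ (0.1038 * Real.log t + 0.2573 * Real.log (Real.log t) + 9.3675)) → (∀ s : ℂ, riemannZeta s = 0 → 2 ≤ |s.im| → s.re ≤ 1 - 1 / (5.573412 * Real.log |s.im|)) → ∀ T : ℝ, Literature.NumberTheory.DiophantineGeometry.RiemannHypothesisUpTo T → ((∀ ρ : ℂ, (fun ρ : ℂ ↦ if 0 < ρ.re ∧ ρ.re < 1 then (Literature.NumberTheory.LFunctions.riemannZetaZeroOrder ρ).toNat else 0) ρ ≠ 0 → 0 < ρ.re ∧ ρ.re < 1) ∧ (∀ ρ : ℂ, (fun ρ : ℂ ↦ if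 0 < ρ.re ∧ ρ.re < 1 then (Literature.NumberTheory.LFunctions.riemannZetaZeroOrder ρ).toNat else 0) ((starRingEnd ℂ) ρ) = (fun ρ : ℂ ↦ if 0 < ρ.re ∧ ρ.re < 1 then (Literature.NumberTheory.LFunctions.riemannZetaZeroOrder ρ).toNat else 0) ρ ∧ (fun ρ : ℂ ↦ if 0 < ρ.re ∧ ρ.re < 1 then (Literature.NumberTheory.LFunctions.riemannZetaZeroOrder ρ).toNat else 0) (1 - (starRingEnd ℂ) ρ) = (fun ρ : ℂ ↦ if 0 < ρ.re ∧ ρ.re < 1 then (Literature.NumberTheory.LFunctions.riemannZetaZeroOrder ρ).toNat else 0) ρ) ∧ (∀ ρ : ℂ, (fun ρ : ℂ ↦ if 0 < ρ.re ∧ ρ.re < 1 then (Literature.NumberTheory.LFunctions.riemannZetaZeroOrder ρ).toNat else 0) ρ ≠ 0 → |ρ.im| ≤ T → ρ.re = 1 / 2) ∧ (∀ ρ : ℂ, (fun ρ : ℂ ↦ if 0 < ρ.re ∧ ρ.re < 1 then (Literature.NumberTheory.LFunctions.riemannZetaZeroOrder ρ).toNat else 0) ρ ≠ 0 → 2 ≤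 |ρ.im| → ρ.re ≤ 1 - 1 / (5.573412 * Real.log |ρ.im|)) ∧ (∀ t : ℝ, {ρ : ℂ | (fun ρ : ℂ ↦ if 0 < ρ.re ∧ ρ.re < 1 then (Literature.NumberTheory.LFunctions.riemannZetaZeroOrder ρ).toNat else 0) ρ ≠ 0 ∧ 0 < ρ.im ∧ ρ.im ≤ t}.Finite) ∧ (∀ t : ℝ, Real.exp 1 ≤ t → |(∑ᶠ ρ ∈ {ρ : ℂ | 0 < ρ.im ∧ ρ.im ≤ t}, ((fun ρ : ℂ ↦ if 0 < ρ.re ∧ ρ.re < 1 then (Literature.NumberTheory.LFunctions.riemannZetaZeroOrder ρ).toNat else 0) ρ : ℝ)) - (t / (2 * Real.pi) * Real.log (t / (2 * Real.pi * Real.exp 1)) + 7 / 8)| ≤ (0.1038 * Real.log t + 0.2573 * Real.log (Real.log t) + 9.3675)))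

/-- item stmt-RiemannHypothesis-22808 · target · rank 0 · closed · moot by None · by planner
why it might fail: it is the conjunction; it fails iff one of LowerLaw / PhantomLaw / PhantomAtPT fails (the two support conjuncts are routine).
sources: Bombieri2000Weil, Yoshida1992, arXiv:2107.06506, arXiv:1410.3926, PlattTrudgian2021
[target] The height-window exchange rate: the spectral expansion of Weil's quadratic functional,
admissibility of the true zeros at every verified height, the lower law (height T certifies every
window <= log T/(8 S*(T)) against all admissible configurations), the phantom law (window 2 log
T/S*(T) is defeated by an admissible configuration at every T >= 10^6) and the phantom at the
Platt-Trudgian height (window 2 defeated at T = 3 000 175 332 800). -/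
@[route_item "route-RiemannHypothesis-WeilHeightWindowBarrier"]
def HeightWindowBarrier : Prop :=
  SpectralExpansion ∧ ZetaAdmissible ∧ LowerLaw ∧ PhantomLaw ∧ PhantomAtPT

/-- item stmt-RiemannHypothesis-22814 · assembly · rank 1 · closed · moot by None · by planner
sources: Bombieri2000Weil
[assembly] the five items imply the target conjunction (one-line typer proof `fun h2 h3 h4 h5 h6 =>
⟨h5, h6, h2, h3, h4⟩`). -/
@[route_item "route-RiemannHypothesis-WeilHeightWindowBarrier", crux]
def Assembly : Prop :=
  LowerLaw → PhantomLaw → PhantomAtPT → SpectralExpansion → ZetaAdmissible → HeightWindowBarrier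

/-! D-0027 §2.1 — DECIDING THEOREM (planner-authored via `route open/edit --closes-file`; by planner-rh-idea-4-g0-0 2026-08-27T21:19:19Z):
its hypotheses are this route's items and its conclusion the sub-problem Statement (glue_lint), and it elaborates with this file. -/

@[closes "route-RiemannHypothesis-WeilHeightWindowBarrier"] theorem closes (h2 : LowerLaw) (h3 : PhantomLaw) (h4 : PhantomAtPT) (h5 : SpectralExpansion)
    (h6 : ZetaAdmissible) (hA : Assembly) : HeightWindowBarrier :=
  hA h2 h3 h4 h5 h6

end Summit.RiemannHypothesis.RiemannHypothesis.Theses.WeilHeightWindowBarrier
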